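import Summits.RiemannHypothesis.RiemannHypothesis.Theorems.SigmaLNoViolation
import Summits.RiemannHypothesis.RiemannHypothesis.Theorems.HardyZLehmerSplitSigmaLSmooth
import Summits.RiemannHypothesis.RiemannHypothesis.Theorems.HardyZLehmerSplitSigmaLstub_secondDerivTest
import Summits.RiemannHypothesis.RiemannHypothesis.Theses.HardyZLehmerSplit
import Mathlib.Analysis.Calculus.Deriv.Slope
import HarnessLib

/-!
# Crux `SigmaL` (stmt-RiemannHypothesis-24253) — the Laguerre inequality at critical points of `Z`
# from "RH in a padded window" (RH-free given the window), and under RH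

Skeleton `SigmaL_birth` has the registered stub

  `stub_laguerreAtCritical : ∀ t > 3·10¹², Z'(t) = 0 → Z(t) ≠ 0 → Z(t)·Z''(t) < 0`

(`Z = Literature.NumberTheory.LFunctions.hardyZ`, total `deriv`s). RH-free this is open (it implies
"no Lehmer violation above `3·10¹²`", i.e. the crux `SigmaL`, which is known in print only from RH:
Ivić 2003 §2 Prop. 1). This file proves the stub's conclusion

* on any window `(A, B)`, `A ≥ 3·10¹²`, from the hypothesis that the zeros of `ζ` with ordinate in
  `(A', B') ⊇ (A − ½, B + 8]` lie on the critical line (`laguerreAtCritical_of_onLine`, RH-free given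
  the window hypothesis);
* for all `t > 3·10¹²` under `RiemannHypothesis` (`laguerreAtCritical_of_riemannHypothesis`: the
  stub is RH-implied, hence consistent and exactly of RH strength in its regime);
* (in `Theorems/HardyZLehmerSplitSigmaLLaguerreW0.lean`) UNCONDITIONALLY on the window
  `W0 = (H₀ + 20, H₀ + 30)`, `H₀ = 3 000 175 332 800`, from the certified computation
  `SigmaLCert.stub_onLine_W0`;

and records (§6) the RH-free CONTRAPOSITIVES — violation locators: a wrong-curvature/degenerate
critical point, or a wrong-sign local extremum, of `Z` at `t ≥ 3·10¹² + 1` forces a zero of `ζ` OFF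
the line with ordinate in `(t − 3/2, t + 9)` (Ivić's criterion, local and effective) —, (§7) the
full `t`-line Laguerre inequality `Z·Z'' − Z'² ≤ −(1/64 − 4/A)·Z²` off the zeros of `Z` from the same
window hypothesis / under RH (`laguerre_quantitative_of_onLine`, `laguerre_of_onLine`,
`laguerre_of_riemannHypothesis`), and the
reduction of the crux to this one stub: `SigmaL_of_laguerreAtCritical` — the birth
skeleton's composition `SigmaL_of` with its calculus stub `stub_secondDerivTest` now PROVED
(`Theorems/HardyZLehmerSplitSigmaLstub_secondDerivTest.lean`), the statement of
`stub_laguerreAtCritical` being the hypothesis verbatim.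

Method: the in-tree LOCAL IVIĆ machinery (`Theorems/SigmaLLocalIvic.lean`: `Z'/Z = Σ pairTerm + c(t)`,
`tsum_decrement_local`, `Ivic2003.corr_sub_le`) is QUANTITATIVE — on a zero-free interval inside the
window `Z'/Z` drops by at least `(t₂ − t₁)(1/C₀² − 4/A)` across `[t₁, t₂]` (`logDeriv_decrement`,
`C₀ = 8` = distance to the next critical zero, `zetaZeroCount_lt_add_eight`). Hence at a critical
point `t` with `Z(t) ≠ 0` the derivative of `Z'/Z`, which is `Z''(t)/Z(t)` (`Z ∈ C²`,
`Theorems/HardyZLehmerSplitSigmaLSmooth.lean`), is `≤ −(1/64 − 4/A) < 0`, i.e. `Z(t) Z''(t) < 0`.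

NOTHING HERE PROVES OR ASSUMES RH unconditionally; the stub `stub_laguerreAtCritical` itself stays
OPEN (RH-strength). References: Ivić 2003 §2 [Ivic2003]; Edwards 1974 §8.3 [Edwards1974].
-/

set_option linter.dupNamespace false
set_option autoImplicit false

noncomputable section

open Complex Filter Set
open scoped Real Topology
open Literature.NumberTheory.LFunctions
open Summit.RiemannHypothesis.RiemannHypothesis.Theorems.SigmaLRung

namespace Summit.RiemannHypothesis.RiemannHypothesis.Theorems.SigmaLBirth

/-! ## §1. The quantitative local Ivić decrement of `Z'/Z` -/

/-- **Quantitative local Ivić.** Under the hypotheses of `SigmaLRung.localIvic` (zeros with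
ordinate in `(A', B') ⊇ (A − ½, B + ½)` on the line, a critical zero in `(t, t + C₀]` for every
`t ∈ (A, B)`, `1 ≤ A`), on a zero-free interval `(a, a') ⊆ [A, B]` of `Z` the logarithmic
derivative drops linearly: for `a < t₁ < t₂ < a'`,
`(t₂ − t₁)(1/C₀² − 4/A) ≤ Z'/Z(t₁) − Z'/Z(t₂)` (useful when `4C₀² < A`, the rate being then
positive). (Same proof as `localIvic`, keeping the constant: the zero sum drops by `≥ (t₂−t₁)/C₀²`,
the smooth part rises by `≤ 4(t₂−t₁)/t₁ ≤ 4(t₂−t₁)/A`.)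
RH-free given the window hypothesis. [cite: Ivic2003, §2, proof of Prop. 1] -/
theorem logDeriv_decrement {A B A' B' C₀ a a' t₁ t₂ : ℝ} (hA1 : 1 ≤ A)
    (hA' : A' ≤ A - 1 / 2) (hB' : B + 1 / 2 ≤ B')
    (hline : ∀ s : ℂ, riemannZeta s = 0 → A' < s.im → s.im < B' → s.re = 1 / 2)
    (hnear : ∀ t : ℝ, A < t → t < B →
      ∃ γ : ℝ, t < γ ∧ γ ≤ t + C₀ ∧ riemannZeta (1 / 2 + (γ : ℂ) * I) = 0)
    (ha : A ≤ a) (ha' : a' ≤ B) (hfree : ∀ t ∈ Ioo a a', hardyZ t ≠ 0)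
    (ht₁ : t₁ ∈ Ioo a a') (ht₂ : t₂ ∈ Ioo a a') (hlt : t₁ < t₂) :
    (t₂ - t₁) * (1 / C₀ ^ 2 - 4 / A) ≤
      deriv hardyZ t₁ / hardyZ t₁ - deriv hardyZ t₂ / hardyZ t₂ := by
  obtain ⟨d, hd⟩ := exists_isHadamardSeq 0
  have hZ : ∀ t ∈ Ioo a a', riemannZeta (1 / 2 + (t : ℂ) * I) ≠ 0 := fun t ht h0 ↦
    hfree t ht ((hardyZ_eq_zero_iff_holds t).2 h0)
  have hform : ∀ t ∈ Ioo a a', deriv hardyZ t / hardyZ t =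
      (∑' n, pairTerm d n t) +
        (-(2 * t / (t ^ 2 + 1 / 4)) +
          (Complex.digamma ((1 / 4 : ℂ) + ((t / 2 : ℝ) : ℂ) * I)).im / 2) := by
    intro t ht
    have hξ : riemannXi ((1 / 2 : ℂ) + (t : ℂ) * I) ≠ 0 := fun h0 ↦
      hZ t ht ((riemannXi_eq_zero_iff_holds _).1 h0).1
    rw [Ivic2003.deriv_hardyZ_div_eq (hZ t ht), Ivic2003.neg_im_logDeriv_zeta_critPt (hZ t ht),
      ← (hasSum_pairTerm hd hξ).tsum_eq]
    ring
  rw [hform t₁ ht₁, hform t₂ ht₂]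
  have hAt₁ : A < t₁ := lt_of_le_of_lt ha ht₁.1
  have ht₂B : t₂ < B := lt_of_lt_of_le ht₂.2 ha'
  obtain ⟨γ, hγ1, hγ2, hγζ⟩ := hnear t₁ hAt₁ (hlt.trans ht₂B)
  have hS := tsum_decrement_local hd (by linarith) hfree ht₁ ht₂ hlt (by linarith) (by linarith)
    hline hγζ hγ1 hγ2
  have hc := Ivic2003.corr_sub_le (by linarith : (1 : ℝ) ≤ t₁) hlt.le
  have hApos : 0 < A := by linarith
  have hcA : 4 * (t₂ - t₁) / t₁ ≤ 4 * (t₂ - t₁) / A :=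
    div_le_div_of_nonneg_left (by linarith) hApos hAt₁.le
  have e : (t₂ - t₁) * (1 / C₀ ^ 2 - 4 / A) = (t₂ - t₁) / C₀ ^ 2 - 4 * (t₂ - t₁) / A := by ring
  rw [e]
  linarith

/-! ## §2. From the linear decrement to the sign of `Z''/Z` at a critical point -/

/-- If `g` drops at least linearly with rate `c` across every pair of points of an open interval
around `t` (`(t₂ − t₁)·c ≤ g t₁ − g t₂` for `t₁ < t₂`), and `g` has derivative `g'` at `t`, then
`g' ≤ −c` (limit of the slopes, all `≤ −c`). [folklore] -/
theorem hasDerivAt_le_neg_of_decrement {g : ℝ → ℝ} {g' c a a' t : ℝ} (hat : a < t) (hta' : t < a')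
    (hdec : ∀ t₁ t₂ : ℝ, t₁ ∈ Ioo a a' → t₂ ∈ Ioo a a' → t₁ < t₂ → (t₂ - t₁) * c ≤ g t₁ - g t₂)
    (hg : HasDerivAt g g' t) : g' ≤ -c := by
  have hslope : Tendsto (slope g t) (𝓝[≠] t) (𝓝 g') := hasDerivAt_iff_tendsto_slope.mp hg
  have htmem : t ∈ Ioo a a' := ⟨hat, hta'⟩
  have hev : ∀ᶠ s in 𝓝[≠] t, slope g t s ≤ -c := by
    have hmem : Ioo a a' ∈ 𝓝[≠] t := mem_nhdsWithin_of_mem_nhds (Ioo_mem_nhds hat hta')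
    filter_upwards [hmem, self_mem_nhdsWithin] with s hs hne
    rw [slope_def_field]
    rcases lt_or_gt_of_ne hne with h | h
    · -- `s < t`
      have hd := hdec s t hs htmem h
      rw [div_le_iff_of_neg (sub_neg.2 h)]
      linarith
    · -- `t < s`
      have hd := hdec t s htmem hs h
      rw [div_le_iff₀ (sub_pos.2 h)]
      linarith
  exact le_of_tendsto hslope hev

/-- At a critical point `t` of `Z` (`Z'(t) = 0`) with `Z(t) ≠ 0`, `Z'/Z` has derivative
`Z''(t)/Z(t)` (`Z ∈ C²`: `hasDerivAt_deriv_hardyZ`, `differentiable_hardyZ`). [folklore] -/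
theorem hasDerivAt_logDeriv_hardyZ_critical {t : ℝ} (hd : deriv hardyZ t = 0) (hZ : hardyZ t ≠ 0) :
    HasDerivAt (fun s ↦ deriv hardyZ s / hardyZ s) (deriv (deriv hardyZ) t / hardyZ t) t := by
  have h := (hasDerivAt_deriv_hardyZ t).div (differentiable_hardyZ t).hasDerivAt hZ
  have e : (deriv (deriv hardyZ) t * hardyZ t - deriv hardyZ t * deriv hardyZ t) / hardyZ t ^ 2 =
      deriv (deriv hardyZ) t / hardyZ t := by
    rw [hd, mul_zero, sub_zero, sq, mul_div_mul_right _ _ hZ]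
  rw [e] at h
  exact h

/-! ## §3. The Laguerre inequality at critical points, from RH in a padded window -/

/-- **`Z·Z'' < 0` at the critical points of `Z` in `(A, B)` (`A ≥ 3·10¹²`) from the zeros of `ζ`
with ordinate in `(A', B') ⊇ (A − ½, B + 8]` being on the line.** For `A < t < B` with `Z'(t) = 0`,
`Z(t) ≠ 0`: `Z` keeps its sign on an interval around `t` inside `(A, B)`; there `Z'/Z` drops at
rate `≥ 1/64 − 4/A > 0` (`logDeriv_decrement` with `C₀ = 8`, the next critical zero being within `8`
by `criticalZeroWithin_of_onLine`), so `Z''(t)/Z(t) = (Z'/Z)'(t) ≤ −(1/64 − 4/A) < 0`.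
RH-free given the window hypothesis; nothing here bears on the truth of RH.
[cite: Ivic2003, §2 Prop. 1 (localised, at critical points)] -/
theorem laguerreAtCritical_of_onLine {A B A' B' : ℝ} (hA : 3000000000000 ≤ A)
    (hA' : A' ≤ A - 1 / 2) (hB' : B + 8 ≤ B')
    (hline : ∀ s : ℂ, riemannZeta s = 0 → A' < s.im → s.im < B' → s.re = 1 / 2) :
    ∀ t : ℝ, A < t → t < B → deriv hardyZ t = 0 → hardyZ t ≠ 0 →
      hardyZ t * deriv (deriv hardyZ) t < 0 := by
  intro t hAt htB hd hZ
  have hnear := criticalZeroWithin_of_onLine hA (by linarith) hB' hline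
  -- `Z ≠ 0` on an interval `(t − δ, t + δ) ⊆ (A, B)`
  obtain ⟨ε, hε, hball⟩ :=
    Metric.eventually_nhds_iff.1 ((continuous_hardyZ.continuousAt (x := t)).eventually_ne hZ)
  set δ : ℝ := min ε (min (t - A) (B - t)) with hδ
  have hδpos : 0 < δ := lt_min hε (lt_min (by linarith) (by linarith))
  have hδε : δ ≤ ε := min_le_left _ _
  have hδA : δ ≤ t - A := (min_le_right _ _).trans (min_le_left _ _)
  have hδB : δ ≤ B - t := (min_le_right _ _).trans (min_le_right _ _)
  have hfree : ∀ u ∈ Ioo (t - δ) (t + δ), hardyZ u ≠ 0 := by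
    intro u hu
    refine hball ?_
    rw [Real.dist_eq, abs_lt]
    constructor <;> linarith [hu.1, hu.2]
  -- the linear decrement of `Z'/Z` there, rate `c = 1/64 − 4/A > 0`
  have hdec : ∀ t₁ t₂ : ℝ, t₁ ∈ Ioo (t - δ) (t + δ) → t₂ ∈ Ioo (t - δ) (t + δ) → t₁ < t₂ →
      (t₂ - t₁) * (1 / (8 : ℝ) ^ 2 - 4 / A) ≤
        deriv hardyZ t₁ / hardyZ t₁ - deriv hardyZ t₂ / hardyZ t₂ :=
    fun t₁ t₂ ht₁ ht₂ hlt ↦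
      logDeriv_decrement (C₀ := 8) (by linarith) hA' (by linarith : B + 1 / 2 ≤ B')
        hline hnear (by linarith) (by linarith) hfree ht₁ ht₂ hlt
  have hle := hasDerivAt_le_neg_of_decrement (by linarith) (by linarith) hdec
    (hasDerivAt_logDeriv_hardyZ_critical hd hZ)
  have hcpos : 0 < 1 / (8 : ℝ) ^ 2 - 4 / A := by
    rw [sub_pos, div_lt_div_iff₀ (by linarith) (by norm_num)]
    linarith
  have hq : deriv (deriv hardyZ) t / hardyZ t < 0 := by linarith
  have hsq : 0 < hardyZ t ^ 2 := by positivity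
  have e : hardyZ t * deriv (deriv hardyZ) t =
      (deriv (deriv hardyZ) t / hardyZ t) * hardyZ t ^ 2 := by
    field_simp
  rw [e]
  exact mul_neg_of_neg_of_pos hq hsq

/-! ## §4. Corollary: under RH, for all `t > 3·10¹²` -/

/-- **The stub `stub_laguerreAtCritical` is RH-implied:** under `RiemannHypothesis`, for every
`t > 3·10¹²` with `Z'(t) = 0` and `Z(t) ≠ 0` one has `Z(t)·Z''(t) < 0` (the registered signature,
verbatim, behind the hypothesis RH). CONDITIONAL; it does not close the stub and nothing here bears on
the truth of RH. [cite: Ivic2003, §2 Prop. 1] -/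
theorem laguerreAtCritical_of_riemannHypothesis (hRH : RiemannHypothesis) :
    ∀ t : ℝ, 3000000000000 < t → deriv hardyZ t = 0 → hardyZ t ≠ 0 →
      hardyZ t * deriv (deriv hardyZ) t < 0 := by
  intro t ht hd hZ
  have hline : ∀ s : ℂ, riemannZeta s = 0 → (3000000000000 : ℝ) - 1 / 2 < s.im →
      s.im < t + 1 + 8 → s.re = 1 / 2 := by
    intro s hs him _
    refine hRH s hs ?_ ?_
    · rintro ⟨n, hn⟩
      have h0 : s.im = 0 := by
        rw [hn]
        simp
      linarith
    · intro h1
      have h0 : s.im = 0 := by rw [h1]; simp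
      linarith
  exact laguerreAtCritical_of_onLine (A := 3000000000000) (B := t + 1) le_rfl le_rfl le_rfl hline
    t ht (by linarith) hd hZ

/-! ## §5. The crux reduces to the one remaining stub -/

/-- **`SigmaL` from the Laguerre inequality at critical points alone** (the crux BY NAME from the
statement of the remaining registered stub `stub_laguerreAtCritical`, verbatim, as hypothesis): the
birth skeleton's composition with the calculus stub `stub_secondDerivTest` discharged. At a positive
local minimum `Z' = 0`, `Z'' ≥ 0` contradicts `Z·Z'' < 0`; symmetrically at a negative local maximum.
An unconditional REDUCTION (credits nothing toward closing the crux); nothing here bears on the truth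
of RH. -/
theorem SigmaL_of_laguerreAtCritical
    (hL : ∀ t : ℝ, 3000000000000 < t → deriv hardyZ t = 0 → hardyZ t ≠ 0 →
      hardyZ t * deriv (deriv hardyZ) t < 0) :
    Summit.RiemannHypothesis.RiemannHypothesis.Theses.HardyZLehmerSplit.SigmaL := by
  intro t ht
  refine ⟨fun hmin ↦ ?_, fun hmax ↦ ?_⟩
  · by_contra hpos
    push Not at hpos
    obtain ⟨hd, hdd⟩ := (stub_secondDerivTest t).1 hmin
    have := hL t ht hd hpos.ne'
    nlinarith [mul_nonneg hpos.le hdd]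
  · by_contra hneg
    push Not at hneg
    obtain ⟨hd, hdd⟩ := (stub_secondDerivTest t).2 hmax
    have := hL t ht hd hneg.ne
    nlinarith [mul_nonneg_of_nonpos_of_nonpos hneg.le hdd]

/-! ## §6. Contrapositives: violation locators (RH-free, unconditional) -/

/-- **Laguerre-violation locator (unconditional).** If Hardy's `Z` has, at some `t ∈ (A, B)` with
`A ≥ 3·10¹²`, a critical point (`Z'(t) = 0`) with `Z(t) ≠ 0` and `Z(t)·Z''(t) ≥ 0` (wrong curvature,
or a degenerate critical point), then `ζ` has a zero OFF the critical line with ordinate in every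
padded window `(A', B') ⊇ (A − ½, B + 8]`. Contrapositive of `laguerreAtCritical_of_onLine`; Ivić's
criterion (a Lehmer-type violation refutes RH) made LOCAL and EFFECTIVE. Nothing is assumed about RH.
[cite: Ivic2003, §2 Prop. 1 (contrapositive, localised)] -/
theorem exists_offLine_zero_of_laguerre_violation {A B A' B' t : ℝ} (hA : 3000000000000 ≤ A)
    (hA' : A' ≤ A - 1 / 2) (hB' : B + 8 ≤ B') (hAt : A < t) (htB : t < B)
    (hd : deriv hardyZ t = 0) (hZ : hardyZ t ≠ 0) (hviol : 0 ≤ hardyZ t * deriv (deriv hardyZ) t) :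
    ∃ s : ℂ, riemannZeta s = 0 ∧ A' < s.im ∧ s.im < B' ∧ s.re ≠ 1 / 2 := by
  by_contra h
  push Not at h
  exact absurd (laguerreAtCritical_of_onLine hA hA' hB' h t hAt htB hd hZ) (not_lt.2 hviol)

/-- **Laguerre-violation locator, pointwise:** a wrong-curvature or degenerate critical point of `Z`
at `t ≥ 3·10¹² + 1` (`Z'(t) = 0`, `Z(t) ≠ 0`, `Z(t)·Z''(t) ≥ 0`) forces a zero of `ζ` off the critical
line with ordinate in `(t − 3/2, t + 9)`. Unconditional; nothing is assumed about RH. -/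
theorem exists_offLine_zero_near_of_laguerre_violation {t : ℝ} (ht : 3000000000000 + 1 ≤ t)
    (hd : deriv hardyZ t = 0) (hZ : hardyZ t ≠ 0) (hviol : 0 ≤ hardyZ t * deriv (deriv hardyZ) t) :
    ∃ s : ℂ, riemannZeta s = 0 ∧ t - 3 / 2 < s.im ∧ s.im < t + 9 ∧ s.re ≠ 1 / 2 :=
  exists_offLine_zero_of_laguerre_violation (A := t - 1) (B := t + 1) (by linarith) (by linarith)
    (by linarith) (by linarith) (by linarith) hd hZ hviol

/-- **Lehmer-violation locator (unconditional).** If Hardy's `Z` has a positive local minimum or a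
negative local maximum at some `t ∈ (A, B)` with `A ≥ 3·10¹²`, then `ζ` has a zero OFF the critical
line with ordinate in every padded window `(A', B') ⊇ (A − ½, B + 8]`. Contrapositive of the RH-free
local Ivić theorem `SigmaLRung.noViolationOn_of_onLine`; Ivić's criterion made LOCAL and EFFECTIVE.
Nothing is assumed about RH. [cite: Ivic2003, §2 Prop. 1 (contrapositive, localised)] -/
theorem exists_offLine_zero_of_lehmer_violation {A B A' B' t : ℝ} (hA : 3000000000000 ≤ A)
    (hA' : A' ≤ A - 1 / 2) (hB' : B + 8 ≤ B') (hAt : A < t) (htB : t < B)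
    (hviol : (IsLocalMin hardyZ t ∧ 0 < hardyZ t) ∨ (IsLocalMax hardyZ t ∧ hardyZ t < 0)) :
    ∃ s : ℂ, riemannZeta s = 0 ∧ A' < s.im ∧ s.im < B' ∧ s.re ≠ 1 / 2 := by
  by_contra h
  push Not at h
  have hno := noViolationOn_of_onLine hA hA' hB' h t hAt htB
  rcases hviol with ⟨hmin, hpos⟩ | ⟨hmax, hneg⟩
  · exact absurd (hno.1 hmin) (not_le.2 hpos)
  · exact absurd (hno.2 hmax) (not_le.2 hneg)

/-- **Lehmer-violation locator, pointwise:** a positive local minimum or negative local maximum of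
`Z` at `t ≥ 3·10¹² + 1` forces a zero of `ζ` off the critical line with ordinate in
`(t − 3/2, t + 9)`. Unconditional; nothing is assumed about RH. -/
theorem exists_offLine_zero_near_of_lehmer_violation {t : ℝ} (ht : 3000000000000 + 1 ≤ t)
    (hviol : (IsLocalMin hardyZ t ∧ 0 < hardyZ t) ∨ (IsLocalMax hardyZ t ∧ hardyZ t < 0)) :
    ∃ s : ℂ, riemannZeta s = 0 ∧ t - 3 / 2 < s.im ∧ s.im < t + 9 ∧ s.re ≠ 1 / 2 :=
  exists_offLine_zero_of_lehmer_violation (A := t - 1) (B := t + 1) (by linarith) (by linarith)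
    (by linarith) (by linarith) (by linarith) hviol

/-! ## §7. The full Laguerre inequality `Z·Z'' − Z'² < 0` on the `t`-line, from RH in a window -/

/-- Wherever `Z(t) ≠ 0`, `Z'/Z` has derivative `(Z''(t)·Z(t) − Z'(t)²)/Z(t)²` (`Z ∈ C²`).
[folklore] -/
theorem hasDerivAt_logDeriv_hardyZ {t : ℝ} (hZ : hardyZ t ≠ 0) :
    HasDerivAt (fun s ↦ deriv hardyZ s / hardyZ s)
      ((deriv (deriv hardyZ) t * hardyZ t - deriv hardyZ t * deriv hardyZ t) / hardyZ t ^ 2) t :=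
  (hasDerivAt_deriv_hardyZ t).div (differentiable_hardyZ t).hasDerivAt hZ

/-- **The Laguerre inequality for Hardy's `Z` on `(A, B)`, `A ≥ 3·10¹²`, from the zeros of `ζ` with
ordinate in `(A', B') ⊇ (A − ½, B + 8]` being on the line — QUANTITATIVE:** at every `t ∈ (A, B)`
with `Z(t) ≠ 0`, `Z(t)·Z''(t) − Z'(t)² ≤ −(1/64 − 4/A)·Z(t)²` (and at a zero of `Z` the left side is
`−Z'(t)² ≤ 0` trivially). From the linear decrement of `Z'/Z` (`logDeriv_decrement`, rate
`1/64 − 4/A > 0`) and `(Z'/Z)' = (Z Z'' − Z'²)/Z²`. RH-free given the window hypothesis; under RH this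
is the `t`-line Laguerre inequality (`Ξ` in the Laguerre–Pólya class) made effective above `3·10¹²`.
Nothing here bears on the truth of RH. [cite: Ivic2003, §2 Prop. 1 (localised)] -/
theorem laguerre_quantitative_of_onLine {A B A' B' : ℝ} (hA : 3000000000000 ≤ A)
    (hA' : A' ≤ A - 1 / 2) (hB' : B + 8 ≤ B')
    (hline : ∀ s : ℂ, riemannZeta s = 0 → A' < s.im → s.im < B' → s.re = 1 / 2) :
    ∀ t : ℝ, A < t → t < B → hardyZ t ≠ 0 →
      hardyZ t * deriv (deriv hardyZ) t - deriv hardyZ t ^ 2 ≤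
        -(1 / (8 : ℝ) ^ 2 - 4 / A) * hardyZ t ^ 2 := by
  intro t hAt htB hZ
  have hnear := criticalZeroWithin_of_onLine hA (by linarith) hB' hline
  obtain ⟨ε, hε, hball⟩ :=
    Metric.eventually_nhds_iff.1 ((continuous_hardyZ.continuousAt (x := t)).eventually_ne hZ)
  set δ : ℝ := min ε (min (t - A) (B - t)) with hδ
  have hδpos : 0 < δ := lt_min hε (lt_min (by linarith) (by linarith))
  have hδε : δ ≤ ε := min_le_left _ _
  have hδA : δ ≤ t - A := (min_le_right _ _).trans (min_le_left _ _)
  have hδB : δ ≤ B - t := (min_le_right _ _).trans (min_le_right _ _)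
  have hfree : ∀ u ∈ Ioo (t - δ) (t + δ), hardyZ u ≠ 0 := by
    intro u hu
    refine hball ?_
    rw [Real.dist_eq, abs_lt]
    constructor <;> linarith [hu.1, hu.2]
  have hdec : ∀ t₁ t₂ : ℝ, t₁ ∈ Ioo (t - δ) (t + δ) → t₂ ∈ Ioo (t - δ) (t + δ) → t₁ < t₂ →
      (t₂ - t₁) * (1 / (8 : ℝ) ^ 2 - 4 / A) ≤
        deriv hardyZ t₁ / hardyZ t₁ - deriv hardyZ t₂ / hardyZ t₂ :=
    fun t₁ t₂ ht₁ ht₂ hlt ↦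
      logDeriv_decrement (C₀ := 8) (by linarith) hA' (by linarith : B + 1 / 2 ≤ B')
        hline hnear (by linarith) (by linarith) hfree ht₁ ht₂ hlt
  have hle := hasDerivAt_le_neg_of_decrement (by linarith) (by linarith) hdec
    (hasDerivAt_logDeriv_hardyZ hZ)
  -- `(Z''Z − Z'²)/Z² ≤ −c`, multiply by `Z² > 0`
  have hsq : 0 < hardyZ t ^ 2 := by positivity
  have hmul := mul_le_mul_of_nonneg_right hle hsq.le
  have e : (deriv (deriv hardyZ) t * hardyZ t - deriv hardyZ t * deriv hardyZ t) / hardyZ t ^ 2 *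
      hardyZ t ^ 2 = hardyZ t * deriv (deriv hardyZ) t - deriv hardyZ t ^ 2 := by
    field_simp
  rw [e] at hmul
  exact hmul

/-- **The Laguerre inequality `Z·Z'' − Z'² < 0` on `(A, B)` off the zeros of `Z`** (`A ≥ 3·10¹²`,
zeros of `ζ` with ordinate in `(A', B') ⊇ (A − ½, B + 8]` on the line). RH-free given the window
hypothesis; nothing here bears on the truth of RH. -/
theorem laguerre_of_onLine {A B A' B' : ℝ} (hA : 3000000000000 ≤ A)
    (hA' : A' ≤ A - 1 / 2) (hB' : B + 8 ≤ B')
    (hline : ∀ s : ℂ, riemannZeta s = 0 → A' < s.im → s.im < B' → s.re = 1 / 2) :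
    ∀ t : ℝ, A < t → t < B → hardyZ t ≠ 0 →
      hardyZ t * deriv (deriv hardyZ) t - deriv hardyZ t ^ 2 < 0 := by
  intro t hAt htB hZ
  have h := laguerre_quantitative_of_onLine hA hA' hB' hline t hAt htB hZ
  have hcpos : 0 < 1 / (8 : ℝ) ^ 2 - 4 / A := by
    rw [sub_pos, div_lt_div_iff₀ (by linarith) (by norm_num)]
    linarith
  have hsq : 0 < hardyZ t ^ 2 := by positivity
  nlinarith

/-- **Under RH: the Laguerre inequality `Z(t)·Z''(t) − Z'(t)² < 0` at every `t > 3·10¹²` with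
`Z(t) ≠ 0`** (CONDITIONAL on `RiemannHypothesis`; at zeros of `Z` it reads `−Z'² ≤ 0`). Nothing here
bears on the truth of RH. [cite: Ivic2003, §2 Prop. 1] -/
theorem laguerre_of_riemannHypothesis (hRH : RiemannHypothesis) :
    ∀ t : ℝ, 3000000000000 < t → hardyZ t ≠ 0 →
      hardyZ t * deriv (deriv hardyZ) t - deriv hardyZ t ^ 2 < 0 := by
  intro t ht hZ
  have hline : ∀ s : ℂ, riemannZeta s = 0 → (3000000000000 : ℝ) - 1 / 2 < s.im →
      s.im < t + 1 + 8 → s.re = 1 / 2 := by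
    intro s hs him _
    refine hRH s hs ?_ ?_
    · rintro ⟨n, hn⟩
      have h0 : s.im = 0 := by
        rw [hn]
        simp
      linarith
    · intro h1
      have h0 : s.im = 0 := by rw [h1]; simp
      linarith
  exact laguerre_of_onLine (A := 3000000000000) (B := t + 1) le_rfl le_rfl le_rfl hline t ht
    (by linarith) hZ

end Summit.RiemannHypothesis.RiemannHypothesis.Theorems.SigmaLBirth

end
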